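import Mathlib.NumberTheory.NumberField.AdeleRing
import Mathlib.RingTheory.TensorProduct.Basic
import Mathlib.Algebra.BigOperators.Finprod
import Mathlib.Algebra.BigOperators.GroupWithZero.Action
import Mathlib.LinearAlgebra.FiniteDimensional.Defs
import Literature.NumberTheory.Automorphic.QuaternionAlgebraAdelic
import Literature.NumberTheory.Automorphic.HeckeAlgebra
import HarnessLib

-- provenance: harness21/H21/H21/Prelude/AutomorphicAxiomatic/QuaternionicForms.lean @ 315230b (interim HEAD d8f2665); M5 mechanical rewrite
/-!
# Algebraic automorphic forms on (definite) quaternion algebras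

Trunk `AutomorphicAxiomatic` (G19), item C8b `QuaternionicForms` (outline D2(b), split off from
`QuaternionAlgebraAdelic` per review F10); namespace `Literature.Automorphic`.

Let `K` be a number field, `D` a `K`-algebra (typically a totally definite quaternion algebra),
`D_fˣ = (D ⊗_K 𝔸_K^∞)ˣ = finiteAdelicUnits K D` and `U ≤ D_fˣ` a (compact open) subgroup.
An **algebraic automorphic form** of level `U` with coefficients in an abelian group `R` is a
function `f : D_fˣ → R` with `f (d x u) = f x` for `d ∈ Dˣ`, `u ∈ U`
(Gross, *Algebraic modular forms*, Israel J. Math. 113 (1999), §4; Taylor, *On Galois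
representations associated to Hilbert modular forms*, Invent. Math. 98 (1989), §1; the shape of
FLT's `TotallyDefiniteQuaternionAlgebra.WeightTwoAutomorphicForm` is copied, not its code).

Contents:

* `QuaternionicForm D U R` with `FunLike`, `ext`, pointwise `AddCommGroup` and `Module S`
  structures (all real), `QuaternionicForm.const`, `QuaternionicForm.levelMono`
  (the outline's `level_mono`, renamed per Mathlib naming of definitions).
* Hecke operators `QuaternionicForm.heckeOperator S g = [UgU]`,
  `(T_g f)(x) = ∑_{yU ⊆ UgU} f (x y)`, a `finsum` over the `U`-orbit of `gU` in `D_fˣ ⧸ U` with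
  representatives `Quotient.out`, exactly as `heckeOperator` in `HeckeAlgebra`. Left
  `Dˣ`-invariance and right `U`-invariance (independence of representatives) are proved;
  additivity uses finiteness of `UgU/U`, i.e. Mathlib's Hecke-pair class
  `[IsHeckeTriple ⊤ U U]` (automatic for `U` compact open, `isHeckeTriple_top_of_isCompact_isOpen`).
  `heckeOperator_comm` (`sorry`) under the Gelfand-pair hypothesis of `HeckeAlgebra`.
* Finiteness (`sorry`): `finite_doubleQuotient` (`Dˣ\D_fˣ/U` finite for `U` open; Fujisaki's
  lemma / finiteness of class numbers, Vignéras III §5, Borel 1963 Thm. 5.1), stated via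
  `MulAction.orbitRel.Quotient` of the subgroup `(inclFinite K D).range ≅ Dˣ` acting on `D_fˣ ⧸ U`
  (Mathlib has `Doset` only for two subgroups of the same group, which also fits, but the orbit
  formulation avoids coercing `Dˣ` into `D_fˣ` pointwise), and
  `finiteDimensional_quaternionicForm`.

Remark (no formal bridge, outline C8b): for `D` totally definite (`IsTotallyDefinite K D`),
`D_∞ˣ/K_∞ˣ` is compact and `QuaternionicForm D U ℂ` is the space of `U`-fixed, right
`D_∞ˣ`-invariant vectors in `L²(Dˣ A_G \ D_𝔸ˣ)` of `AutomorphicSpectrum`, i.e. automorphic forms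
of weight `2` (trivial weight) on `Dˣ` (Gross 1999 §4, Prop. 4.5; Taylor 1989 §1). The finiteness
statements below do not need definiteness and are stated without it.

## Mathlib searches

Mathlib has no automorphic forms on quaternion algebras (`rg WeightTwoAutomorphicForm`,
`AutomorphicForm`, `algebraic modular` : nothing); it has `MulAction.orbitRel.Quotient`,
`finsum`, `IsHeckeTriple`, `FiniteDimensional`, all used here.
-/

noncomputable section

open scoped TensorProduct Pointwise
open NumberField

universe u

namespace Literature.NumberTheory.Automorphic

variable {K : Type} [Field K] [NumberField K]

/-- An **algebraic (quaternionic) automorphic form** of level `U ≤ D_fˣ` with coefficients in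
`R`: a function `f : (D ⊗_K 𝔸_K^∞)ˣ → R` which is left invariant under `Dˣ` (embedded
diagonally by `inclFinite`) and right invariant under `U` (Gross 1999 §4, eq. (4.1) with trivial
weight; Taylor 1989 §1; FLT `WeightTwoAutomorphicForm`). [cite: Gross1999, §4  eq. (4.1] -/
structure QuaternionicForm (D : Type u) [Ring D] [Algebra K D]
    (U : Subgroup (finiteAdelicUnits K D)) (R : Type*) [AddCommGroup R] where
  /-- The underlying function `D_fˣ → R`. -/
  toFun : finiteAdelicUnits K D → R
  /-- Left invariance under `Dˣ`. -/
  left_invt' : ∀ (d : Dˣ) (x : finiteAdelicUnits K D), toFun (inclFinite K D d * x) = toFun x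
  /-- Right invariance under the level `U`. -/
  right_invt' : ∀ u ∈ U, ∀ x : finiteAdelicUnits K D, toFun (x * u) = toFun x

namespace QuaternionicForm

variable {D : Type u} [Ring D] [Algebra K D] {U : Subgroup (finiteAdelicUnits K D)}
  {R : Type*} [AddCommGroup R]

/-- Quaternionic forms are functions `D_fˣ → R` (Gross 1999 §4). [cite: Gross1999, §4] -/
instance instFunLike : FunLike (QuaternionicForm D U R) (finiteAdelicUnits K D) R where
  coe := toFun
  coe_injective f g h := by cases f; cases g; congr

/-- `f.toFun = ⇑f`. [folklore] -/
@[simp] theorem toFun_eq_coe (f : QuaternionicForm D U R) : f.toFun = ⇑f := rfl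

/-- The coercion of an anonymous constructor. [folklore] -/
@[simp] theorem coe_mk (f : finiteAdelicUnits K D → R) (h₁ h₂) :
    ⇑(mk (U := U) f h₁ h₂) = f := rfl

/-- Two quaternionic forms are equal if they agree as functions. [folklore] -/
@[ext] theorem ext {f g : QuaternionicForm D U R} (h : ∀ x, f x = g x) : f = g :=
  DFunLike.ext f g h

/-- Left `Dˣ`-invariance `f (d x) = f x` (Gross 1999 §4). [cite: Gross1999, §4] -/
@[simp] theorem left_invt (f : QuaternionicForm D U R) (d : Dˣ) (x : finiteAdelicUnits K D) :
    f (inclFinite K D d * x) = f x := f.left_invt' d x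

/-- Right `U`-invariance `f (x u) = f x` (Gross 1999 §4). [cite: Gross1999, §4] -/
theorem right_invt (f : QuaternionicForm D U R) {u : finiteAdelicUnits K D} (hu : u ∈ U)
    (x : finiteAdelicUnits K D) : f (x * u) = f x := f.right_invt' u hu x

/-! ### Pointwise algebraic structure -/

/-- The zero form. [folklore] -/
instance instZero : Zero (QuaternionicForm D U R) := ⟨⟨0, fun _ _ => rfl, fun _ _ _ => rfl⟩⟩

/-- Pointwise addition of forms. [folklore] -/
instance instAdd : Add (QuaternionicForm D U R) :=
  ⟨fun f g => ⟨fun x => f x + g x, fun d x => by simp, fun u hu x => by simp [right_invt _ hu]⟩⟩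

/-- Pointwise negation of forms. [folklore] -/
instance instNeg : Neg (QuaternionicForm D U R) :=
  ⟨fun f => ⟨fun x => -f x, fun d x => by simp, fun u hu x => by simp [right_invt _ hu]⟩⟩

/-- Pointwise subtraction of forms. [folklore] -/
instance instSub : Sub (QuaternionicForm D U R) :=
  ⟨fun f g => ⟨fun x => f x - g x, fun d x => by simp, fun u hu x => by simp [right_invt _ hu]⟩⟩

/-- Pointwise scalar multiplication of forms by any scalars acting on `R` (in particular `ℕ`,
`ℤ`, and a coefficient ring `S` with `[Module S R]`). [folklore] -/
instance instSMul {S : Type*} [SMul S R] : SMul S (QuaternionicForm D U R) :=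
  ⟨fun c f => ⟨fun x => c • f x, fun d x => by simp, fun u hu x => by simp [right_invt _ hu]⟩⟩

/-- `⇑0 = 0`. [folklore] -/
@[simp, norm_cast] theorem coe_zero : ⇑(0 : QuaternionicForm D U R) = 0 := rfl

/-- `⇑(f + g) = ⇑f + ⇑g`. [folklore] -/
@[simp, norm_cast] theorem coe_add (f g : QuaternionicForm D U R) : ⇑(f + g) = ⇑f + ⇑g := rfl

/-- `⇑(-f) = -⇑f`. [folklore] -/
@[simp, norm_cast] theorem coe_neg (f : QuaternionicForm D U R) : ⇑(-f) = -⇑f := rfl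

/-- `⇑(f - g) = ⇑f - ⇑g`. [folklore] -/
@[simp, norm_cast] theorem coe_sub (f g : QuaternionicForm D U R) : ⇑(f - g) = ⇑f - ⇑g := rfl

/-- `⇑(c • f) = c • ⇑f`. [folklore] -/
@[simp, norm_cast] theorem coe_smul {S : Type*} [SMul S R] (c : S) (f : QuaternionicForm D U R) :
    ⇑(c • f) = c • ⇑f := rfl

/-- Quaternionic forms of level `U` form an abelian group under pointwise operations
(Gross 1999 §4: `M(U, R)` is an `R`-module). [cite: Gross1999, §4:  M(U  R] -/
instance instAddCommGroup : AddCommGroup (QuaternionicForm D U R) :=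
  DFunLike.coe_injective.addCommGroup _ coe_zero coe_add coe_neg coe_sub
    (fun _ _ => coe_smul _ _) (fun _ _ => coe_smul _ _)

/-- The coercion to functions as an additive monoid homomorphism. [folklore] -/
def coeAddHom : QuaternionicForm D U R →+ (finiteAdelicUnits K D → R) where
  toFun := (⇑)
  map_zero' := coe_zero
  map_add' := coe_add

/-- `coeAddHom f = ⇑f`. [folklore] -/
@[simp] theorem coeAddHom_apply (f : QuaternionicForm D U R) : coeAddHom f = ⇑f := rfl

/-- Quaternionic forms with coefficients in an `S`-module `R` form an `S`-module under pointwise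
operations (Gross 1999 §4). [cite: Gross1999, §4] -/
instance instModule {S : Type*} [Semiring S] [Module S R] : Module S (QuaternionicForm D U R) :=
  DFunLike.coe_injective.module S coeAddHom coe_smul

variable (U) in
/-- The constant form with value `r` (the "Eisenstein" or trivial forms of Gross 1999 §4). [cite: Gross1999, §4] -/
def const (r : R) : QuaternionicForm D U R := ⟨fun _ => r, fun _ _ => rfl, fun _ _ _ => rfl⟩

/-- `const U r x = r`. [folklore] -/
@[simp] theorem const_apply (r : R) (x : finiteAdelicUnits K D) : const U r x = r := rfl

section Level

variable (S : Type*) [Semiring S] [Module S R]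

/-- **Change of level**: a form of level `U` is a form of any smaller level `U' ≤ U` (the same
function); an `S`-linear injection `M(U, R) → M(U', R)` (Gross 1999 §4; Taylor 1989 §1). [cite: Gross1999, §4] -/
def levelMono {U' : Subgroup (finiteAdelicUnits K D)} (h : U' ≤ U) :
    QuaternionicForm D U R →ₗ[S] QuaternionicForm D U' R where
  toFun f := ⟨f, f.left_invt', fun _ hu x => f.right_invt (h hu) x⟩
  map_add' _ _ := rfl
  map_smul' _ _ := rfl

/-- `levelMono` does not change the underlying function. [folklore] -/
@[simp] theorem coe_levelMono {U' : Subgroup (finiteAdelicUnits K D)} (h : U' ≤ U)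
    (f : QuaternionicForm D U R) : ⇑(levelMono S h f) = ⇑f := rfl

/-- `levelMono` is injective. [folklore] -/
theorem levelMono_injective {U' : Subgroup (finiteAdelicUnits K D)} (h : U' ≤ U) :
    Function.Injective (levelMono (R := R) S h) := fun f g hfg =>
  ext fun x => by simpa using congrArg (fun k => k x) hfg

end Level

/-! ### Hecke operators -/

section Hecke

/-- The raw **Hecke operator** `[UgU]` on a single form:
`(T_g f)(x) = ∑_{yU ⊆ UgU} f (x y)`, the `finsum` over the `U`-orbit of `gU` in `D_fˣ ⧸ U` with
representatives `y = Quotient.out (yU)` (as in `heckeOperator` of `HeckeAlgebra`). The value is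
independent of the representatives by right `U`-invariance of `f`, and `T_g f` is again a form
(both proved here, for arbitrary `U`); if `UgU/U` is infinite the `finsum` is the junk value `0`
(Gross 1999 §4, eq. (4.4); Taylor 1989 §1; Shimura §3.1). [cite: Gross1999, §4  eq. (4.4] -/
def heckeOperatorFun (g : finiteAdelicUnits K D) (f : QuaternionicForm D U R) :
    QuaternionicForm D U R where
  toFun x := ∑ᶠ y ∈ MulAction.orbit U (g : finiteAdelicUnits K D ⧸ U), f (x * y.out)
  left_invt' d x := by simp_rw [mul_assoc, left_invt]
  right_invt' u hu x := by
    refine finsum_mem_eq_of_bijOn (fun y => (⟨u, hu⟩ : U) • y) ⟨fun y hy => ?_, fun y _ z _ h => ?_,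
      fun z hz => ?_⟩ (fun y _ => ?_)
    · exact MulAction.mem_orbit_of_mem_orbit _ hy
    · exact smul_left_cancel _ h
    · exact ⟨(⟨u, hu⟩ : U)⁻¹ • z, MulAction.mem_orbit_of_mem_orbit _ hz, smul_inv_smul _ _⟩
    · -- both `u * y.out` and `(u • y).out` represent the coset `u • y`
      obtain ⟨h', H'⟩ := QuotientGroup.mk_out_eq_mul U (u * y.out)
      have hxy : ((⟨u, hu⟩ : U) • y) = ((u * y.out : finiteAdelicUnits K D) : _ ⧸ U) := by
        conv_lhs => rw [← QuotientGroup.out_eq' y]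
        rfl
      rw [hxy, H', ← mul_assoc, ← mul_assoc, f.right_invt h'.2]

/-- Pointwise formula for `heckeOperatorFun` (definitional). [folklore] -/
theorem heckeOperatorFun_apply (g : finiteAdelicUnits K D) (f : QuaternionicForm D U R)
    (x : finiteAdelicUnits K D) :
    heckeOperatorFun g f x =
      ∑ᶠ y ∈ MulAction.orbit U (g : finiteAdelicUnits K D ⧸ U), f (x * y.out) := rfl

variable (S : Type*) [Semiring S] [Module S R]
  [IsHeckeTriple (⊤ : Submonoid (finiteAdelicUnits K D)) U U]

/-- The **Hecke operator** `T_g = [UgU] : M(U, R) →ₗ[S] M(U, R)`,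
`(T_g f)(x) = ∑_{yU ⊆ UgU} f (x y)` (Gross 1999 §4, eq. (4.4) and Prop. 4.3; Taylor 1989 §1).
Linearity needs `UgU/U` finite, guaranteed by the Hecke-pair hypothesis
`[IsHeckeTriple ⊤ U U]` (`finite_orbit_quotient`; it holds for `U` compact open by
`isHeckeTriple_top_of_isCompact_isOpen`). Take `S = ℤ` for the bare additive version. [cite: Gross1999, §4  eq. (4.4] -/
def heckeOperator (g : finiteAdelicUnits K D) :
    QuaternionicForm D U R →ₗ[S] QuaternionicForm D U R where
  toFun := heckeOperatorFun g
  map_add' f f' := ext fun x => by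
    simp only [heckeOperatorFun_apply, coe_add, Pi.add_apply]
    exact finsum_mem_add_distrib (finite_orbit_quotient U g)
  map_smul' c f := ext fun x => by
    simp only [heckeOperatorFun_apply, coe_smul, Pi.smul_apply, RingHom.id_apply]
    exact (smul_finsum_mem (finite_orbit_quotient U g)).symm

/-- Pointwise formula for the Hecke operator: `(T_g f)(x) = ∑ᶠ_{yU ⊆ UgU} f (x y)`
(definitional; Gross 1999 eq. (4.4)). [cite: Gross1999, eq. (4.4] -/
theorem heckeOperator_apply (g : finiteAdelicUnits K D) (f : QuaternionicForm D U R)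
    (x : finiteAdelicUnits K D) :
    heckeOperator S g f x =
      ∑ᶠ y ∈ MulAction.orbit U (g : finiteAdelicUnits K D ⧸ U), f (x * y.out) := rfl

/-- The Hecke operator computed with *any* transversal `s` of `UgU/U`:
`(T_g f)(x) = ∑_{y ∈ s} f (x y)` (Gross 1999 §4; Shimura, Prop. 3.1). [cite: Gross1999, §4] -/
theorem heckeOperator_apply_eq_sum (g : finiteAdelicUnits K D) (s : Finset (finiteAdelicUnits K D))
    (hs : Set.BijOn (fun y : finiteAdelicUnits K D => (y : finiteAdelicUnits K D ⧸ U)) s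
      (MulAction.orbit U (g : finiteAdelicUnits K D ⧸ U)))
    (f : QuaternionicForm D U R) (x : finiteAdelicUnits K D) :
    heckeOperator S g f x = ∑ y ∈ s, f (x * y) := by
  rw [heckeOperator_apply, ← finsum_mem_coe_finset]
  refine (finsum_mem_eq_of_bijOn _ hs fun y _ => ?_).symm
  obtain ⟨h, H⟩ := QuotientGroup.mk_out_eq_mul U y
  rw [H, ← mul_assoc, f.right_invt h.2]

/-- The Hecke operator of the trivial double coset `U1U = U` is the identity
(Gross 1999 §4). [cite: Gross1999, §4] -/
theorem heckeOperator_one : heckeOperator (U := U) (R := R) S 1 = LinearMap.id := by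
  refine LinearMap.ext fun f => ext fun x => ?_
  rw [heckeOperator_apply_eq_sum S 1 {1}, Finset.sum_singleton, mul_one, LinearMap.id_apply]
  refine ⟨by simp [MulAction.mem_orbit_self], by simp, fun z hz => ?_⟩
  obtain ⟨u, rfl⟩ := hz
  refine ⟨1, by simp, ?_⟩
  change (((1 : finiteAdelicUnits K D)) : _ ⧸ U) = (((u : finiteAdelicUnits K D) * 1 : _) : _ ⧸ U)
  rw [QuotientGroup.eq]
  simp

/-- **Commutativity of Hecke operators** when `(D_fˣ, U)` is a Gelfand pair over `ℤ`, i.e. the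
abstract Hecke algebra `ℋ(D_fˣ, U)` of `HeckeAlgebra` is commutative: `M(U, R)` is the space of
`U`-fixed vectors of the right-regular representation on left-`Dˣ`-invariant functions, on
which `ℋ(D_fˣ, U)` acts through `T_g` (`exists_algHom_moduleEnd_fixedPoints`). Classically
this is applied place by place: `T_v` and `T_w` commute for `v ≠ w` unramified with `U_v, U_w`
maximal (Gross 1999 §4, Prop. 4.3; Shimura, Thm. 3.20). [cite: Gross1999, §4  Prop. 4.3] -/
def heckeOperator_comm : Prop :=
  ∀ (hG : IsGelfandPair ℤ (finiteAdelicUnits K D) U) (g g' : finiteAdelicUnits K D),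
    heckeOperator (U := U) (R := R) S g ∘ₗ heckeOperator S g' =
      heckeOperator S g' ∘ₗ heckeOperator S g

end Hecke

/-! ### Finiteness -/

section Finite

variable (U)

/-- **Finiteness of the double quotient** `Dˣ \ D_fˣ / U` for an open subgroup `U` of
`D_fˣ = (D ⊗ 𝔸_K^∞)ˣ`, `D` a quaternion algebra over a number field: the set of orbits of
`Dˣ` (as the subgroup `(inclFinite K D).range` of `D_fˣ`) on `D_fˣ ⧸ U` is finite. For `D`
totally definite this is Fujisaki's lemma (compactness of `Dˣ \ D_𝔸^{(1)}`, Vignéras III §1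
Thm. 1.4, V §2); in general it is the finiteness of the class number of the algebraic group `Dˣ`
(Borel, *Some finiteness properties of adele groups over number fields*, Publ. IHÉS 16 (1963),
Thm. 5.1). Definiteness is therefore not assumed. [cite: BorelIHES1963, Thm. 5.1 (finiteness of the class number)] [cite: VignerasLNM800, Ch. III §1 Thm. 1.4 and Ch. V §2 (totally definite case)] -/
def finite_doubleQuotient : Prop :=
  ∀ [IsQuaternionAlgebra K D] (hU : IsOpen (U : Set (finiteAdelicUnits K D))),
    Finite (MulAction.orbitRel.Quotient (inclFinite K D).range (finiteAdelicUnits K D ⧸ U))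

/-- **Finite-dimensionality of quaternionic forms**: for a quaternion algebra `D` over a number
field and an open level `U`, the space `M(U, ℂ)` of `ℂ`-valued forms is finite-dimensional, of
dimension `#(Dˣ \ D_fˣ / U)` (a form is a function on this finite set, `finite_doubleQuotient`;
Gross 1999 §4, Prop. 4.3; Taylor 1989 §1). For `D` totally definite (`IsTotallyDefinite K D`)
these are the automorphic forms of trivial weight on `Dˣ`; the finiteness itself does not use
definiteness, which is therefore not assumed. [cite: Gross1999, §4  Prop. 4.3] -/
def finiteDimensional_quaternionicForm : Prop :=
  ∀ [IsQuaternionAlgebra K D] (hU : IsOpen (U : Set (finiteAdelicUnits K D))),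
    FiniteDimensional ℂ (QuaternionicForm D U ℂ)

end Finite

end QuaternionicForm

end Literature.NumberTheory.Automorphic
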